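import Summits.ResolutionOfSingularities.ResolutionOfSingularities.Theorems.FrameStep4
import Summits.ResolutionOfSingularities.ResolutionOfSingularities.Theorems.KCert
import Summits.ResolutionOfSingularities.ResolutionOfSingularities.Theorems.TightDefectClasses
import Literature.AlgebraicGeometry.Resolution.OrdZeroBasics
import HarnessLib

/-!
# «KRoot» — the stage-0 frame: centring at a `K`-rational point, and cleaning to a ROOT state

(lens-5 g39, node g39l; critic ROW 232 Q2a / ROW 238 window, door (M-Dict); letters 238a f1–f7 / 238b–g.)

Layer C5/E of the (M-Dict) dictionary `towerDictionary_holds` starts the `frame_step` induction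
[Theorems/FrameStep4] from a frame `θ₀ : K[Z,u] → L′` with `B(θ₀) = B̃₀` (the stage-0 carrier of the
`K`-thread) and `θ₀ (Z^q + F₀) = f₀` for a ROOT residual `F₀` (`TightDefectClasses.IsRoot`).  This file supplies
the two generic moves producing it, over ANY local subring `B'` of a field `L ⊇ K`:

* §1 `exists_centred_frame` — given a frame `Θ : K[Z,u] → L` with variables in `B'` and `K`-rational residues on
  `B'` (`∀ w ∈ B', ∃ c, w − c ∈ 𝔪_{B'}`), the re-centred frame `θ = Θ ∘ (u ↦ u − b, Z ↦ Z − c)` has its variables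
  in `𝔪_{B'}`, `B(θ) ≤ B'`, contains every quotient `Θ y / Θ z` with `Θ z ∈ B'ˣ`, and
  `θ (Z^q + translate b G + c^q) = Θ (Z^q + G)` (Frobenius additivity, `q = p^e`);
* §2 `exists_clean_frame` — given a centred frame `θ` with `B(θ) = B'` and `θ (Z^q + G) ∈ 𝔪_{B'}^q`, the cleaning
  `Z ↦ Z − h(u)` (`G + h^q = G♭ := deletePthPowers q G`, `K` perfect) gives a frame `θ'` with the same local ring
  and `u`-variables, `θ' (Z^q + G♭) = θ (Z^q + G)`, and `G♭` clean of order `≥ q` with all monomials of degree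
  `≥ q` — i.e. `⟨G♭, 0⟩` is a ROOT state and satisfies the standing hypothesis `hs` of `frame_step`.

* §3 `exists_root_frame` — §1 + §2 packaged with the fraction certificate `B' ≤ B(θ)` (`FrameStep.le_frameRing_of_frac`):
  from `Θ`, a generating subring `C ≤ B'` and `Θ (Z^q + F) ∈ 𝔪_{B'}^q` to a frame `θ₀` with `B(θ₀) = B'` and a ROOT state `s₀`
  with `θ₀ (Z^q + s₀.F) = Θ (Z^q + F)`;
* §4 `kframe_step` — ONE STEP of the frame induction along the `K`-thread: `FrameStep.frame_step` fed with the transported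
  and re-based certificate (`KCert.transport`, `KCert.exists_cert_of_eq`) and the factorisation `f = w · c_j^q · f'` of the
  stalk generators [Theorems/StalkThread2, `inextStage_fact`], returning the next frame with `B(θ') = B̃'`, the invariant
  `θ' (Z^q + s'.F) = v' · f'` (`v'` a unit), equimultiplicity of the step and the degree bound.

Everything is elementary algebra over the landed frame calculus [Theorems/FrameStep2, FrameStep3, FrameStep4, KCert]
(`frameRing`, `maxSet`, `unitSet`, `shift`/`unshift`, `framePoly`, `comp_unshift_framePoly`,
`mem_pow_idealOfVars_of_mem_pow`, `frame_step`).  (Sources: Hauser2010 §F–§G (cleaning); Matsumura1987 §6; folklore.)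
-/

open MvPolynomial
open Literature.AlgebraicGeometry.Resolution
open Literature.AlgebraicGeometry.Resolution.Hauser2010
open Literature.AlgebraicGeometry.Resolution.PointBlowup
open Summit.ResolutionOfSingularities.ResolutionOfSingularities.Theorems.FrameStep
open Summit.ResolutionOfSingularities.ResolutionOfSingularities.Theorems.TightDefectClasses (IsRoot)
open Summit.ResolutionOfSingularities.ResolutionOfSingularities.Theorems.ShallowPort (PointBlowupCert)

set_option linter.dupNamespace false

namespace Summit.ResolutionOfSingularities.ResolutionOfSingularities.Theorems.KRoot

noncomputable section

variable {σ : Type} {K : Type} [Field K] {L : Type} [Field L] [Algebra K L] {B' : Subring L}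

/-! ## §1 Centring a frame at a `K`-rational point of a local subring -/

/-- **The centred frame.**  Let `Θ : K[Z,u] → L` be an injective frame whose variables lie in a local subring
`B' ⊇ K` of `L` on which residues are `K`-rational (`∀ w ∈ B', ∃ c ∈ K, w − c ∈ 𝔪_{B'}`).  Then for suitable
`b : σ → K`, `c : K` the re-centred frame `θ = Θ ∘ (u_m ↦ u_m − b_m, Z ↦ Z − c)` is injective, has all its
variables in `𝔪_{B'}`, satisfies `B(θ) ≤ B'`, contains every quotient `Θ y / Θ z` with `Θ z` a unit of `B'`,
and `θ (Z^q + translate b G + c^q) = Θ (Z^q + G)` for every `G ∈ K[u]` (`q = p^e`). -/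
theorem exists_centred_frame (p : ℕ) [Fact p.Prime] [CharP K p] (e : ℕ) [IsLocalRing B']
    (Θ : MvPolynomial (Option σ) K →ₐ[K] L) (hΘ : Function.Injective Θ)
    (hK : ∀ c : K, algebraMap K L c ∈ B') (hX : ∀ o, Θ (X o) ∈ B')
    (hrat : ∀ w ∈ B', ∃ c : K, w - algebraMap K L c ∈ maxSet B') :
    ∃ (b : σ → K) (c : K) (θ : MvPolynomial (Option σ) K →ₐ[K] L) (hθ : Function.Injective θ),
      (∀ o, θ (X o) ∈ maxSet B') ∧ frameRing θ hθ ≤ B' ∧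
      (∀ m, θ (X (some m)) = Θ (X (some m)) - algebraMap K L (b m)) ∧
      θ (X none) = Θ (X none) - algebraMap K L c ∧
      (∀ y z : MvPolynomial (Option σ) K, Θ z ∈ unitSet B' → Θ y / Θ z ∈ frameRing θ hθ) ∧
      ∀ G : MvPolynomial σ K,
        θ (framePoly (p ^ e) (PointBlowup.translate b G + C (c ^ p ^ e))) = Θ (framePoly (p ^ e) G) := by
  choose a ha using fun o => hrat (Θ (X o)) (hX o)
  set b : σ → K := fun m => a (some m) with hb_def
  set c : K := a none with hc_def
  set θ := Θ.comp (unshift b (C c)) with hθ_def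
  have hθi : Function.Injective θ := hΘ.comp (unshift_injective b (C c))
  have hΘθ : ∀ P, Θ P = θ (shift b (C c) P) := fun P => by
    rw [hθ_def, AlgHom.comp_apply, unshift_shift]
  have hθm : ∀ m, θ (X (some m)) = Θ (X (some m)) - algebraMap K L (b m) := fun m => by
    rw [hθ_def, AlgHom.comp_apply, unshift_X_some, map_sub, algHom_C]
  have hθZ : θ (X none) = Θ (X none) - algebraMap K L c := by
    have ht : PointBlowup.translate (-b) (C c : MvPolynomial σ K) = C c := by
      simp [PointBlowup.translate]
    rw [hθ_def, AlgHom.comp_apply, unshift_X_none, map_sub, ht, rename_C, algHom_C]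
  have hvars : ∀ o, θ (X o) ∈ maxSet B' := by
    rintro (_ | m)
    · rw [hθZ]
      exact ha none
    · rw [hθm]
      exact ha (some m)
  refine ⟨b, c, θ, hθi, hvars, frameRing_le θ hθi hK hvars, hθm, hθZ, fun y z hz => ?_, fun G => ?_⟩
  · rw [hΘθ y, hΘθ z]
    refine (mem_frameRing_iff θ hθi).mpr ⟨_, _, not_mem_of_eval_mem_unitSet θ hK hvars ?_, rfl⟩
    rw [← hΘθ z]
    exact hz
  · rw [hθ_def]
    exact comp_unshift_framePoly p e Θ b (C c) G _ (by rw [map_pow])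

/-! ## §2 Cleaning a centred frame to a ROOT state -/

/-- **Cleaning at the root.**  Let `θ : K[Z,u] → L` be an injective frame centred in the local subring `B' = B(θ)`
(variables in `𝔪_{B'}`), `K` perfect of characteristic `p`, `q = p^e`, and `G ∈ K[u]` with `θ (Z^q + G) ∈ 𝔪_{B'}^q`.
With `G + h^q = G♭ := deletePthPowers q G` (Hauser's cleaning), the frame `θ' = θ ∘ (Z ↦ Z − h(u))` is injective,
`B(θ') = B'`, its variables lie in `𝔪_{B'}` with the same `u`-variables as `θ`, `θ' (Z^q + G♭) = θ (Z^q + G)`;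
and `G♭` is clean, of order `≥ q`, with every monomial of degree `≥ q`. -/
theorem exists_clean_frame [DecidableEq σ] (p : ℕ) [Fact p.Prime] [CharP K p] [PerfectField K] (e : ℕ)
    [IsLocalRing B'] (θ : MvPolynomial (Option σ) K →ₐ[K] L) (hθ : Function.Injective θ)
    (hB : frameRing θ hθ = B') (hvars : ∀ o, θ (X o) ∈ maxSet B') (G : MvPolynomial σ K)
    (hGq : ∃ hm : θ (framePoly (p ^ e) G) ∈ B',
      (⟨θ (framePoly (p ^ e) G), hm⟩ : B') ∈ IsLocalRing.maximalIdeal B' ^ p ^ e) :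
    ∃ (θ' : MvPolynomial (Option σ) K →ₐ[K] L) (hθ' : Function.Injective θ'),
      frameRing θ' hθ' = B' ∧ (∀ o, θ' (X o) ∈ maxSet B') ∧ (∀ m, θ' (X (some m)) = θ (X (some m))) ∧
      θ' (framePoly (p ^ e) (deletePthPowers (p ^ e) G)) = θ (framePoly (p ^ e) G) ∧
      deletePthPowers (p ^ e) (deletePthPowers (p ^ e) G) = deletePthPowers (p ^ e) G ∧
      ((p ^ e : ℕ) : ℕ∞) ≤ ordZero (deletePthPowers (p ^ e) G) ∧
      ∀ d ∈ (deletePthPowers (p ^ e) G).support, p ^ e ≤ d.degree := by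
  set q := p ^ e with hq_def
  have hq0 : q ≠ 0 := pow_ne_zero e (Fact.out : p.Prime).ne_zero
  have hK : ∀ c : K, algebraMap K L c ∈ B' := fun c => hB.le (algebraMap_mem_frameRing θ hθ c)
  obtain ⟨hfB, hfq⟩ := hGq
  have hf : θ (framePoly q G) ∈ maxSet B' := ⟨hfB, Ideal.pow_le_self hq0 hfq⟩
  -- cleaning: `G + h^q = G♭`
  obtain ⟨h, hh⟩ := exists_add_pow_eq_deletePthPowers p e G
  set D := deletePthPowers q G with hD_def
  have hD : PointBlowup.translate 0 G + h ^ p ^ e = D := by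
    rw [FrameStep.translate_zero]
    exact hh
  -- the cleaned frame `θ' = θ ∘ unshift 0 h`
  set θ' := θ.comp (unshift 0 h) with hθ'_def
  have hθ'i : Function.Injective θ' := hθ.comp (unshift_injective 0 h)
  have hθθ' : ∀ P, θ P = θ' (shift 0 h P) := fun P => by
    rw [hθ'_def, AlgHom.comp_apply, unshift_shift]
  have hθ'm : ∀ m, θ' (X (some m)) = θ (X (some m)) := fun m => by
    rw [hθ'_def, AlgHom.comp_apply, unshift_X_some, map_sub, algHom_C, Pi.zero_apply, map_zero, sub_zero]
  have hfp : θ' (framePoly q D) = θ (framePoly q G) := comp_unshift_framePoly p e θ 0 h G D hD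
  -- `G♭(0) = 0`, so `θ' (G♭) ∈ 𝔪_{B'}`
  have hD0 : D ∈ idealOfVars σ K := by
    rw [mem_idealOfVars_iff, constantCoeff_eq, hD_def, coeff_deletePthPowers, if_pos]
    intro i hi
    simp at hi
  have hφ : ∀ m : σ, (θ'.comp (rename some)) (X m) ∈ maxSet B' := fun m => by
    rw [AlgHom.comp_apply, rename_X, hθ'm]
    exact hvars (some m)
  have hθ'B : ∀ Q : MvPolynomial σ K, θ' (rename some Q) ∈ B' := fun Q =>
    (eval_mem_and_congr (θ'.comp (rename some)) hK hφ Q).1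
  have hDm : θ' (rename some D) ∈ maxSet B' := by
    have := eval_mem_maxSet_of_mem (θ'.comp (rename some)) hK hφ hD0
    rwa [AlgHom.comp_apply] at this
  -- the cleaned frame is centred in `B'`
  have hvars' : ∀ o, θ' (X o) ∈ maxSet B' := by
    rintro (_ | m)
    · have hZeq : θ' (X none) = θ (X none) - θ' (rename some h) := by
        rw [hθ'_def, AlgHom.comp_apply, AlgHom.comp_apply, unshift_X_none, unshift_rename, map_sub]
      have hZB : θ' (X none) ∈ B' := by
        rw [hZeq]
        exact sub_mem (hvars none).1 (hθ'B h)
      refine mem_maxSet_of_pow_mem (n := q) hZB ?_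
      have hZq : θ' (X none) ^ q = θ (framePoly q G) - θ' (rename some D) := by
        rw [← hfp, framePoly, map_add, map_pow]
        ring
      rw [hZq]
      exact sub_mem_maxSet hf hDm
    · rw [hθ'm]
      exact hvars (some m)
  -- `B(θ') = B'`
  have hsub : frameRing θ hθ ≤ frameRing θ' hθ'i := by
    intro x hx
    obtain ⟨a, t, ht, rfl⟩ := (mem_frameRing_iff θ hθ).mp hx
    rw [hθθ' a, hθθ' t]
    refine (mem_frameRing_iff θ' hθ'i).mpr ⟨_, _, not_mem_of_eval_mem_unitSet θ' hK hvars' ?_, rfl⟩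
    rw [← hθθ' t]
    exact eval_mem_unitSet_of_not_mem θ hK hvars ht
  have hB' : frameRing θ' hθ'i = B' :=
    le_antisymm (frameRing_le θ' hθ'i hK hvars') (hB.ge.trans hsub)
  -- all monomials of `G♭` have degree `≥ q`
  have hfq' : framePoly q D ∈ idealOfVars (Option σ) K ^ q := by
    refine mem_pow_idealOfVars_of_mem_pow θ' hθ'i hB' q _ ⟨hB'.le (map_mem_frameRing θ' hθ'i _), ?_⟩
    have he : (⟨θ' (framePoly q D), hB'.le (map_mem_frameRing θ' hθ'i _)⟩ : B') = ⟨θ (framePoly q G), hfB⟩ :=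
      Subtype.ext hfp
    rw [he]
    exact hfq
  have hZq : X none ^ q ∈ idealOfVars (Option σ) K ^ q :=
    Ideal.pow_mem_pow ((mem_idealOfVars_iff _).mpr (constantCoeff_X K none)) q
  have hDq : rename some D ∈ idealOfVars (Option σ) K ^ q := by
    have := Ideal.sub_mem _ hfq' hZq
    rwa [framePoly, add_sub_cancel_left] at this
  have hdeg : ∀ d ∈ D.support, q ≤ d.degree := by
    intro d hd
    have hd' : Finsupp.mapDomain some d ∈ (rename some D).support := by
      rw [support_rename_of_injective (Option.some_injective σ)]
      exact Finset.mem_image_of_mem _ hd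
    have := (mem_pow_idealOfVars_iff q _).mp hDq _ hd'
    rwa [Finsupp.degree_mapDomain] at this
  have hord : ((q : ℕ) : ℕ∞) ≤ ordZero D := by
    rw [natCast_le_ordZero_iff_mem_idealOfVars_pow, mem_pow_idealOfVars_iff]
    exact hdeg
  exact ⟨θ', hθ'i, hB', hvars', hθ'm, hfp, deletePthPowers_deletePthPowers q G, hord, hdeg⟩

/-- **The root state** of a cleaned residual of order `≥ q`: `⟨G♭, 0⟩` is a ROOT state (`TightDefectClasses.IsRoot`). -/
theorem isRoot_of_clean [DecidableEq σ] [DecidableEq K] (q : ℕ) (D : MvPolynomial σ K)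
    (hclean : deletePthPowers q D = D) (hord : ((q : ℕ) : ℕ∞) ≤ ordZero D) :
    IsRoot q (⟨D, 0⟩ : State σ K) :=
  ⟨rfl, hclean, hord⟩

/-! ## §3 The root frame -/

/-- **The root frame.**  Let `Θ : K[Z,u] → L` be an injective frame (`K` perfect of characteristic `p`, `q = p^e`) with variables in a
local subring `B' ⊇ K` of `L` having `K`-rational residues, let `C ≤ B'` be a subring contained in every subring containing `K` and the
quotients `Θ y / Θ z` (`Θ z ∈ B'ˣ`), over which `B'` is a ring of fractions with denominators invertible in `B'`, and let `F ∈ K[u]`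
with `Θ (Z^q + F) ∈ 𝔪_{B'}^q`.  Then there is an injective frame `θ₀` with `B(θ₀) = B'`, variables in `𝔪_{B'}`, and a ROOT state `s₀`
with `θ₀ (Z^q + s₀.F) = Θ (Z^q + F)` and all monomials of `s₀.F` of degree `≥ q`. -/
theorem exists_root_frame [DecidableEq σ] [DecidableEq K] (p : ℕ) [Fact p.Prime] [CharP K p] [PerfectField K] (e : ℕ)
    [IsLocalRing B'] (Θ : MvPolynomial (Option σ) K →ₐ[K] L) (hΘ : Function.Injective Θ)
    (hK : ∀ c : K, algebraMap K L c ∈ B') (hX : ∀ o, Θ (X o) ∈ B')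
    (hrat : ∀ w ∈ B', ∃ c : K, w - algebraMap K L c ∈ maxSet B')
    (C : Subring L) (hC : ∀ R : Subring L, (∀ c : K, algebraMap K L c ∈ R) →
      (∀ y z : MvPolynomial (Option σ) K, Θ z ∈ unitSet B' → Θ y / Θ z ∈ R) → C ≤ R)
    (hfrac : ∀ w ∈ B', ∃ y ∈ C, ∃ z ∈ C, z ≠ 0 ∧ z⁻¹ ∈ B' ∧ w = y / z)
    (F : MvPolynomial σ K)
    (hFq : ∃ hm : Θ (framePoly (p ^ e) F) ∈ B', (⟨Θ (framePoly (p ^ e) F), hm⟩ : B') ∈ IsLocalRing.maximalIdeal B' ^ p ^ e) :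
    ∃ (θ₀ : MvPolynomial (Option σ) K →ₐ[K] L) (hθ₀ : Function.Injective θ₀) (s₀ : State σ K),
      frameRing θ₀ hθ₀ = B' ∧ (∀ o, θ₀ (X o) ∈ maxSet B') ∧
      θ₀ (framePoly (p ^ e) s₀.F) = Θ (framePoly (p ^ e) F) ∧ IsRoot (p ^ e) s₀ ∧
      ∀ d ∈ s₀.F.support, p ^ e ≤ d.degree := by
  obtain ⟨b, c, θ, hθ, hvars, hle, -, -, hquot, hfp⟩ := exists_centred_frame p e Θ hΘ hK hX hrat
  have hCθ : C ≤ frameRing θ hθ := hC _ (algebraMap_mem_frameRing θ hθ) hquot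
  have hB : frameRing θ hθ = B' := le_antisymm hle (le_frameRing_of_frac θ hθ hK hvars C hCθ hfrac)
  set G := PointBlowup.translate b F + MvPolynomial.C (c ^ p ^ e) with hG_def
  have hGq : ∃ hm : θ (framePoly (p ^ e) G) ∈ B',
      (⟨θ (framePoly (p ^ e) G), hm⟩ : B') ∈ IsLocalRing.maximalIdeal B' ^ p ^ e := by
    obtain ⟨hm, hmq⟩ := hFq
    refine ⟨by rw [hfp]; exact hm, ?_⟩
    have he : (⟨θ (framePoly (p ^ e) G), by rw [hfp]; exact hm⟩ : B') = ⟨Θ (framePoly (p ^ e) F), hm⟩ :=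
      Subtype.ext (hfp F)
    rw [he]
    exact hmq
  obtain ⟨θ₀, hθ₀, hB₀, hvars₀, -, hfp₀, hclean, hord, hdeg⟩ := exists_clean_frame p e θ hθ hB hvars G hGq
  exact ⟨θ₀, hθ₀, ⟨deletePthPowers (p ^ e) G, 0⟩, hB₀, hvars₀, by rw [hfp₀, hfp], isRoot_of_clean _ _ hclean hord, hdeg⟩

/-! ## §4 One step of the frame induction along the thread -/

/-- **The frame step along the thread.**  Data: subrings `B ≤ B̃ ≤ B̃'` and `B' ≤ B̃'` of `L` (`B̃'` local), a point blow-up certificate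
`cert : PointBlowupCert B B' M`, the generation of `B̃'` by `B̃ ∪ B'` up to units, an injective frame `θ` with `B(θ) = B̃` whose origin
ideal matches `M B̃`, variables of `θ` in `𝔪_{B̃'}`, `K`-rational residues on `B̃'`, a state `s` (monomials of degree `≥ q = p^e`) with
`θ (Z^q + s.F) = v · f`, and the factorisation `f = w · c_j^q · f'` with `v, w` units of `B̃'` and `f' ∈ 𝔪_{B̃'}^q`.  Then `frame_step`
produces the chart `j`, the point `b` on the exceptional divisor (`b_j = 0`), and an injective frame `θ'` with `B(θ') = B̃'`, variables in
`𝔪_{B̃'}`, `θ' (Z^q + s'.F) = v' · f'` for the next state `s' = step q j b s` and a unit `v'`; the step is equimultiple and `s'.F` has all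
monomials of degree `≥ q`. -/
theorem kframe_step [Fintype σ] [DecidableEq σ] (p : ℕ) [Fact p.Prime] [CharP K p] [PerfectField K] [DecidableEq K] (e : ℕ)
    {B Bt Bt' : Subring L} {B₁ : Subring L} [IsLocalRing Bt'] (hB : B ≤ Bt) (hBt : Bt ≤ Bt') (hB₁ : B₁ ≤ Bt')
    {M : Ideal B} (cert : PointBlowupCert B B₁ M)
    (hgen : ∀ w ∈ Bt', ∃ x ∈ Subring.closure ((Bt : Set L) ∪ B₁), ∃ x' ∈ Subring.closure ((Bt : Set L) ∪ B₁),
      x' ∈ unitSet Bt' ∧ w = x / x')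
    (θ : MvPolynomial (Option σ) K →ₐ[K] L) (hθ : Function.Injective θ) (hBθ : frameRing θ hθ = Bt)
    (hM : ∀ x : L, (∃ hx : x ∈ frameRing θ hθ, (⟨x, hx⟩ : frameRing θ hθ) ∈ originIdeal θ hθ) ↔
      (∃ hx : x ∈ Bt, (⟨x, hx⟩ : Bt) ∈ M.map (Subring.inclusion hB)))
    (hloc : ∀ o, θ (X o) ∈ maxSet Bt') (hrat : ∀ w ∈ Bt', ∃ c : K, w - algebraMap K L c ∈ maxSet Bt')
    (s : State σ K) (hs : ∀ d ∈ s.F.support, p ^ e ≤ d.degree)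
    {f f' v w : L} (hv : v ∈ unitSet Bt') (hw : w ∈ unitSet Bt')
    (hfv : θ (framePoly (p ^ e) s.F) = v * f) (hfact : f = w * (cert.c cert.j : L) ^ p ^ e * f')
    (hf'q : ∃ h : f' ∈ Bt', (⟨f', h⟩ : Bt') ∈ IsLocalRing.maximalIdeal Bt' ^ p ^ e) :
    ∃ (j : σ) (b : σ → K) (θ' : MvPolynomial (Option σ) K →ₐ[K] L) (hθ' : Function.Injective θ'),
      b j = 0 ∧ frameRing θ' hθ' = Bt' ∧ (∀ o, θ' (X o) ∈ maxSet Bt') ∧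
      (∃ v' ∈ unitSet Bt', θ' (framePoly (p ^ e) (step (p ^ e) j b s).F) = v' * f') ∧
      IsEquimultiplePoint (p ^ e) j b s ∧ ∀ d ∈ (step (p ^ e) j b s).F.support, p ^ e ≤ d.degree := by
  set q := p ^ e with hq_def
  have hq0 : q ≠ 0 := pow_ne_zero e (Fact.out : p.Prime).ne_zero
  -- the transported and re-based certificate
  set cert₁ := KCert.transport hB hBt hB₁ cert hgen with hcert₁
  have hc₁ : ((cert₁.c cert₁.j : Bt) : L) = cert.c cert.j := KCert.transport_coe_c_j hB hBt hB₁ cert hgen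
  obtain ⟨cert₂, -, hc₂, -⟩ := KCert.exists_cert_of_eq (B' := Bt') hBθ hM cert₁
  -- the element `g = v w f'`
  obtain ⟨hf'B, hf'q⟩ := hf'q
  have hf' : f' ∈ maxSet Bt' := ⟨hf'B, Ideal.pow_le_self hq0 hf'q⟩
  have hvw : v * w ∈ unitSet Bt' := mul_mem_unitSet hv hw
  set g := v * w * f' with hg_def
  have hg : g ∈ maxSet Bt' := mul_mem_maxSet_left hvw.1 hf'
  have hfg : θ (framePoly q s.F) = ((cert₂.c cert₂.j : frameRing θ hθ) : L) ^ q * g := by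
    rw [hfv, hfact, hc₂, hc₁, hg_def]
    ring
  obtain ⟨j, b, θ', hθ', hbj, hB', -, hvars', ⟨v', hv', hv'g⟩, hlast⟩ :=
    frame_step p e θ hθ hloc hrat cert₂ s hs g hg hfg
  have hgq : ∃ hg' : g ∈ Bt', (⟨g, hg'⟩ : Bt') ∈ IsLocalRing.maximalIdeal Bt' ^ q := by
    refine ⟨mul_mem hvw.1 hf'B, ?_⟩
    have he : (⟨g, mul_mem hvw.1 hf'B⟩ : Bt') = ⟨v * w, hvw.1⟩ * ⟨f', hf'B⟩ := Subtype.ext rfl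
    rw [he]
    exact Ideal.mul_mem_left _ _ hf'q
  obtain ⟨hequi, hdeg⟩ := hlast hgq
  refine ⟨j, b, θ', hθ', hbj, hB', hvars', ⟨v' * (v * w), mul_mem_unitSet hv' hvw, ?_⟩, hequi, hdeg⟩
  rw [hv'g, hg_def]
  ring

end

end Summit.ResolutionOfSingularities.ResolutionOfSingularities.Theorems.KRoot
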